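import Literature.NumberTheory.Automorphic.ReductionTheoryGLnConjugation
import Mathlib.Analysis.SpecialFunctions.Pow.NNReal
import HarnessLib

/-!
# Arithmetic of the Siegel cone: entry bounds, dyadic roots, and a compact box of diagonal elements
(Garrett, *Modern Analysis of Automorphic Forms by Example* (2018), §7.3, Claim 7.3.6 and
Lemma 7.3.12, PDF pp. 335–336, 341–342)

Elementary bricks for the basic estimate for cusp forms on a Siegel set
(`GLnCuspidalSpectrum.norm_smoothedForm_le_of_isSiegelSetGL`, Garrett Thm. 7.3.10), concerning the
cone `A_{T₀}(t)` (`siegelCone` of `ReductionTheoryGLn`: `a = posRealDiagonal b`, `∏ bᵢ = 1`,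
`t bᵢ₊₁ ≤ bᵢ`). The soft multiplicity bound of `Literature.MeasureTheory.Group.HaarTranslateCovering`
controls the Haar measure of `B' · a · C` through a factorisation `a = β^m` with `β` in a fixed
compact set and `m` of logarithmic size in the simple roots of `a`; this file supplies that
factorisation:

* `siegelCone_div_le_pow`, `siegelCone_entry_le` — **entries of cone elements are polynomially
  bounded by the largest simple root**: if all simple roots `bᵢ/bᵢ₊₁` lie in `[t, R]` (`t ≤ 1 ≤ R`)
  and `∏ bᵢ = 1`, then `bᵢ, bᵢ⁻¹ ≤ (max R t⁻¹)^n` (all ratios `bᵢ/bⱼ` are products of at most `n`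
  simple roots or their inverses, and `bᵢ^n = ∏ⱼ bᵢ/bⱼ`).
* `exists_nat_pow_two_ge_le` — a dyadic exponent `m ≥ 1` with `M ≤ 2^m ≤ 4 M` (`M ≥ 1`).
* `exists_units_pow_eq_rpow` — `m`-th roots `βᵢ = bᵢ^{1/m}` in `(ℝ≥0)ˣ`, with `β^m = b`, and
  `half_le_rpow_inv_le_two` — `βᵢ ∈ [1/2, 2]` as soon as `bᵢ ∈ [2^{-m}, 2^m]`; hence
  (`posRealDiagonal_eq_pow_of_rpow`) `a = (posRealDiagonal β)^m`.
* `exists_isCompact_posRealDiagonal_mem_of_box` — **the positive real diagonal elements with entries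
  in `[1/2, 2]` lie in a compact subset of `GL_n(𝔸_K)`** (their matrices and inverses are diagonal
  with entries `(βᵢ, 1)`, `βᵢ ∈ [1/2, 2]`; `Units.exists_isCompact_superset_of_val_of_inv`).

Everything here is proved.

## References

* P. Garrett, *Modern Analysis of Automorphic Forms by Example* (2018), §7.3, Claim 7.3.6 and
  Lemma 7.3.12 (PDF pp. 335–336, 341–342) [Garrett2018].
-/

noncomputable section

open scoped NNReal MatrixGroups Pointwise RestrictedProduct
open NumberField IsDedekindDomain Set
open _root_.Topology

namespace Literature.NumberTheory.Automorphic

variable {n : ℕ} {K : Type} [Field K] [NumberField K]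

/-! ### Ratios and entries on the cone -/

/-- **All ratios of the entries of a cone element are bounded**: if the simple roots satisfy
`t bⱼ ≤ bᵢ` and `bᵢ ≤ R bⱼ` for `j = i + 1` (`0 < t`, `1 ≤ R`), then `bᵢ / bⱼ ≤ (max R t⁻¹)^n` for all
`i, j` (`siegelRoot_div_le_max_pow` for `j ≤ i`, and the same lemma for the inverted family
`bᵢ⁻¹` with parameter `R⁻¹` for `i ≤ j`). (Garrett (2018), proof of Claim 7.3.6.)
[cite: Garrett2018, Claim 7.3.6 (PDF pp. 335–336)] -/
theorem siegelCone_div_le_pow {t R : ℝ} (ht : 0 < t) (hR : 1 ≤ R) {b : Fin n → ℝ≥0ˣ}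
    (hroot : ∀ i j : Fin n, (j : ℕ) = (i : ℕ) + 1 → t * ((b j : ℝ≥0) : ℝ) ≤ ((b i : ℝ≥0) : ℝ))
    (hup : ∀ i j : Fin n, (j : ℕ) = (i : ℕ) + 1 → ((b i : ℝ≥0) : ℝ) ≤ R * ((b j : ℝ≥0) : ℝ))
    (i j : Fin n) :
    ((b i : ℝ≥0) : ℝ) / ((b j : ℝ≥0) : ℝ) ≤ (max R t⁻¹) ^ n := by
  have hpos : ∀ l : Fin n, 0 < ((b l : ℝ≥0) : ℝ) := fun l =>
    NNReal.coe_pos.2 (pos_iff_ne_zero.2 (b l).ne_zero)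
  have hR0 : 0 < R := lt_of_lt_of_le zero_lt_one hR
  have hM : max 1 t⁻¹ ≤ max R t⁻¹ := max_le_max hR le_rfl
  have hM' : max 1 R ≤ max R t⁻¹ := by
    refine max_le (le_trans hR (le_max_left _ _)) (le_max_left _ _)
  have hMnn : 0 ≤ max 1 t⁻¹ := le_trans zero_le_one (le_max_left _ _)
  rcases le_total j i with hji | hij
  · exact (siegelRoot_div_le_max_pow ht hroot hji).trans (pow_le_pow_left₀ hMnn hM n)
  · -- the inverted family `b⁻¹` satisfies the root inequalities with parameter `R⁻¹`
    have hroot' : ∀ i j : Fin n, (j : ℕ) = (i : ℕ) + 1 →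
        R⁻¹ * (((b j)⁻¹ : ℝ≥0ˣ) : ℝ≥0) ≤ ((((b i)⁻¹ : ℝ≥0ˣ) : ℝ≥0) : ℝ) := by
      intro i' j' hj'
      rw [Units.val_inv_eq_inv_val, Units.val_inv_eq_inv_val, NNReal.coe_inv, NNReal.coe_inv, ← mul_inv]
      exact inv_anti₀ (hpos i') (hup i' j' hj')
    have h := siegelRoot_div_le_max_pow (inv_pos.2 hR0) hroot' hij
    rw [inv_inv, Units.val_inv_eq_inv_val, Units.val_inv_eq_inv_val, NNReal.coe_inv, NNReal.coe_inv,
      inv_div_inv] at h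
    exact h.trans (pow_le_pow_left₀ (le_trans zero_le_one (le_max_left _ _)) hM' n)

/-- **Entries of cone elements are polynomially bounded by the largest simple root**: under the
hypotheses of `siegelCone_div_le_pow` and `∏ bᵢ = 1`, `bᵢ ≤ (max R t⁻¹)^n` and
`bᵢ⁻¹ ≤ (max R t⁻¹)^n` for every `i` (`bᵢ^n = ∏ⱼ bᵢ/bⱼ`, `bᵢ^{-n} = ∏ⱼ bⱼ/bᵢ`).
[cite: Garrett2018, Claim 7.3.6 (PDF pp. 335–336)] -/
theorem siegelCone_entry_le {t R : ℝ} (ht : 0 < t) (hR : 1 ≤ R) {b : Fin n → ℝ≥0ˣ}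
    (hprod : (∏ i, ((b i : ℝ≥0) : ℝ)) = 1)
    (hroot : ∀ i j : Fin n, (j : ℕ) = (i : ℕ) + 1 → t * ((b j : ℝ≥0) : ℝ) ≤ ((b i : ℝ≥0) : ℝ))
    (hup : ∀ i j : Fin n, (j : ℕ) = (i : ℕ) + 1 → ((b i : ℝ≥0) : ℝ) ≤ R * ((b j : ℝ≥0) : ℝ))
    (i : Fin n) :
    ((b i : ℝ≥0) : ℝ) ≤ (max R t⁻¹) ^ n ∧ ((b i : ℝ≥0) : ℝ)⁻¹ ≤ (max R t⁻¹) ^ n := by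
  have hpos : ∀ l : Fin n, 0 < ((b l : ℝ≥0) : ℝ) := fun l =>
    NNReal.coe_pos.2 (pos_iff_ne_zero.2 (b l).ne_zero)
  have hn : n ≠ 0 := by
    intro h; subst h; exact Fin.elim0 i
  set M := (max R t⁻¹) ^ n with hMdef
  have hM0 : 0 ≤ M := pow_nonneg (le_trans (le_trans zero_le_one hR) (le_max_left _ _)) n
  have hdiv := siegelCone_div_le_pow ht hR hroot hup
  have hMpow : M ^ n = ∏ _j : Fin n, M := by
    rw [Finset.prod_const, Finset.card_univ, Fintype.card_fin]
  constructor
  · -- `bᵢ^n = ∏ⱼ bᵢ/bⱼ ≤ M^n`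
    have h1 : ((b i : ℝ≥0) : ℝ) ^ n = ∏ j : Fin n, ((b i : ℝ≥0) : ℝ) / ((b j : ℝ≥0) : ℝ) := by
      rw [Finset.prod_div_distrib, hprod, div_one, Finset.prod_const, Finset.card_univ, Fintype.card_fin]
    have h2 : ((b i : ℝ≥0) : ℝ) ^ n ≤ M ^ n := by
      rw [h1, hMpow]
      exact Finset.prod_le_prod (fun j _ => div_nonneg (hpos i).le (hpos j).le) fun j _ => hdiv i j
    exact (pow_le_pow_iff_left₀ (hpos i).le hM0 hn).1 h2
  · -- `bᵢ^{-n} = ∏ⱼ bⱼ/bᵢ ≤ M^n`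
    have h1 : (((b i : ℝ≥0) : ℝ))⁻¹ ^ n = ∏ j : Fin n, ((b j : ℝ≥0) : ℝ) / ((b i : ℝ≥0) : ℝ) := by
      rw [Finset.prod_div_distrib, hprod, one_div, Finset.prod_const, Finset.card_univ, Fintype.card_fin,
        inv_pow]
    have h2 : (((b i : ℝ≥0) : ℝ))⁻¹ ^ n ≤ M ^ n := by
      rw [h1, hMpow]
      exact Finset.prod_le_prod (fun j _ => div_nonneg (hpos j).le (hpos i).le) fun j _ => hdiv j i
    exact (pow_le_pow_iff_left₀ (inv_nonneg.2 (hpos i).le) hM0 hn).1 h2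

/-! ### Dyadic exponents and roots -/

/-- **A dyadic exponent**: for `M ≥ 1` there is `m ≥ 1` with `M ≤ 2^m ≤ 4 M`. [folklore] -/
theorem exists_nat_pow_two_ge_le {M : ℝ} (hM : 1 ≤ M) :
    ∃ m : ℕ, 1 ≤ m ∧ M ≤ (2 : ℝ) ^ m ∧ (2 : ℝ) ^ m ≤ 4 * M := by
  classical
  have hex : ∃ m : ℕ, M ≤ (2 : ℝ) ^ m := by
    obtain ⟨m, hm⟩ := pow_unbounded_of_one_lt M (one_lt_two : (1 : ℝ) < 2)
    exact ⟨m, hm.le⟩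
  set m₀ := Nat.find hex with hm₀
  have hm₀spec : M ≤ (2 : ℝ) ^ m₀ := Nat.find_spec hex
  refine ⟨m₀ + 1, Nat.le_add_left 1 m₀, hm₀spec.trans ?_, ?_⟩
  · exact pow_le_pow_right₀ one_le_two (Nat.le_succ m₀)
  · rw [pow_succ]
    rcases Nat.eq_zero_or_pos m₀ with h0 | hpos
    · rw [h0, pow_zero]; linarith
    · have hlt : ¬ M ≤ (2 : ℝ) ^ (m₀ - 1) := Nat.find_min hex (Nat.sub_lt hpos one_pos)
      have hlt' : (2 : ℝ) ^ (m₀ - 1) < M := lt_of_not_ge hlt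
      have : (2 : ℝ) ^ m₀ = 2 ^ (m₀ - 1) * 2 := by
        rw [← pow_succ, Nat.sub_add_cancel hpos]
      rw [this]; nlinarith

/-- **`m`-th roots in `(ℝ≥0)ˣ`**: for `m ≠ 0` every `b : Fin n → (ℝ≥0)ˣ` is `β^m` with
`βᵢ = bᵢ^{1/m}`. [folklore] -/
theorem exists_units_pow_eq_rpow {m : ℕ} (hm : m ≠ 0) (b : Fin n → ℝ≥0ˣ) :
    ∃ β : Fin n → ℝ≥0ˣ, β ^ m = b ∧ ∀ i, ((β i : ℝ≥0) : ℝ≥0) = ((b i : ℝ≥0)) ^ ((m : ℝ)⁻¹) := by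
  refine ⟨fun i => Units.mk0 (((b i : ℝ≥0)) ^ ((m : ℝ)⁻¹))
    (NNReal.rpow_pos (pos_iff_ne_zero.2 (b i).ne_zero)).ne', ?_, fun i => rfl⟩
  funext i
  refine Units.ext ?_
  rw [Pi.pow_apply, Units.val_pow_eq_pow_val, Units.val_mk0, NNReal.rpow_inv_natCast_pow _ hm]

/-- **Dyadic roots lie in `[1/2, 2]`**: if `2⁻ᵐ ≤ x ≤ 2ᵐ` (`m ≠ 0`) then `1/2 ≤ x^{1/m} ≤ 2`.
[folklore] -/
theorem half_le_rpow_inv_le_two {m : ℕ} (hm : m ≠ 0) {x : ℝ≥0} (h1 : ((1 / 2 : ℝ≥0)) ^ m ≤ x)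
    (h2 : x ≤ (2 : ℝ≥0) ^ m) : (1 / 2 : ℝ≥0) ≤ x ^ ((m : ℝ)⁻¹) ∧ x ^ ((m : ℝ)⁻¹) ≤ 2 := by
  have hm0 : 0 ≤ ((m : ℝ))⁻¹ := inv_nonneg.2 (Nat.cast_nonneg m)
  constructor
  · have h := NNReal.rpow_le_rpow h1 hm0
    rwa [NNReal.pow_rpow_inv_natCast _ hm] at h
  · have h := NNReal.rpow_le_rpow h2 hm0
    rwa [NNReal.pow_rpow_inv_natCast _ hm] at h

/-- **`a = (posRealDiagonal β)^m`** for the `m`-th roots `β` of `b`. [folklore] -/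
theorem posRealDiagonal_eq_pow {m : ℕ} {b β : Fin n → ℝ≥0ˣ} (h : β ^ m = b) :
    posRealDiagonal n K b = (posRealDiagonal n K β) ^ m := by
  rw [← map_pow, h]

/-! ### A compact box of positive real diagonal elements -/

/-- **Positive real diagonal elements with entries in `[1/2, 2]` lie in a compact subset of
`GL_n(𝔸_K)`**: their matrices are diagonal with entries `realAdele K βᵢ`, `βᵢ ∈ [1/2, 2]`, and so are
their inverses (`βᵢ⁻¹ ∈ [1/2, 2]`), so `Units.exists_isCompact_superset_of_val_of_inv` applies with a
compact box of matrices. [folklore] -/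
theorem exists_isCompact_posRealDiagonal_mem_of_box :
    ∃ T : Set (GL (Fin n) (AdeleRing (𝓞 K) K)), IsCompact T ∧
      ∀ β : Fin n → ℝ≥0ˣ, (∀ i, (1 / 2 : ℝ) ≤ ((β i : ℝ≥0) : ℝ) ∧ ((β i : ℝ≥0) : ℝ) ≤ 2) →
        posRealDiagonal n K β ∈ T := by
  haveI : T2Space (FiniteAdeleRing (𝓞 K) K) := inferInstanceAs <| T2Space
    (Πʳ w : HeightOneSpectrum (𝓞 K), [w.adicCompletion K, w.adicCompletionIntegers K])
  haveI : T2Space (InfiniteAdeleRing K) :=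
    inferInstanceAs <| T2Space ((w : InfinitePlace K) → w.Completion)
  haveI : T2Space (AdeleRing (𝓞 K) K) :=
    inferInstanceAs <| T2Space (InfiniteAdeleRing K × FiniteAdeleRing (𝓞 K) K)
  -- the compact set of admissible entries and the compact box of matrices
  set E : Set (AdeleRing (𝓞 K) K) := insert 0 (realAdele K '' Icc (1 / 2) 2) with hE
  have hEc : IsCompact E := (isCompact_Icc.image (continuous_realAdele K)).insert 0
  set CM : Set (Matrix (Fin n) (Fin n) (AdeleRing (𝓞 K) K)) :=
    Set.pi Set.univ fun _ => Set.pi Set.univ fun _ => E with hCM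
  have hCMc : IsCompact CM := isCompact_univ_pi fun _ => isCompact_univ_pi fun _ => hEc
  -- entries of `posRealDiagonal β` for `β` in the box
  have hentry : ∀ β : Fin n → ℝ≥0ˣ, (∀ i, (1 / 2 : ℝ) ≤ ((β i : ℝ≥0) : ℝ) ∧ ((β i : ℝ≥0) : ℝ) ≤ 2) →
      ((posRealDiagonal n K β : GL (Fin n) (AdeleRing (𝓞 K) K)) :
        Matrix (Fin n) (Fin n) (AdeleRing (𝓞 K) K)) ∈ CM := by
    intro β hβ
    refine Set.mem_univ_pi.2 fun i => Set.mem_univ_pi.2 fun j => ?_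
    rw [coe_posRealDiagonal, Matrix.diagonal_apply]
    split_ifs with hij
    · refine Set.mem_insert_of_mem _ ⟨((β i : ℝ≥0) : ℝ), hβ i, ?_⟩
      rw [coe_posRealIdele]
    · exact Set.mem_insert _ _
  set S : Set (GL (Fin n) (AdeleRing (𝓞 K) K)) :=
    {g | ∃ β : Fin n → ℝ≥0ˣ, (∀ i, (1 / 2 : ℝ) ≤ ((β i : ℝ≥0) : ℝ) ∧ ((β i : ℝ≥0) : ℝ) ≤ 2) ∧
      g = posRealDiagonal n K β} with hSdef
  have hS₁ : ∀ g ∈ S, (g : Matrix (Fin n) (Fin n) (AdeleRing (𝓞 K) K)) ∈ CM := by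
    rintro _ ⟨β, hβ, rfl⟩; exact hentry β hβ
  have hS₂ : ∀ g ∈ S, ((g⁻¹ : GL (Fin n) (AdeleRing (𝓞 K) K)) :
      Matrix (Fin n) (Fin n) (AdeleRing (𝓞 K) K)) ∈ CM := by
    rintro _ ⟨β, hβ, rfl⟩
    rw [← map_inv]
    refine hentry β⁻¹ fun i => ?_
    have hpos : 0 < ((β i : ℝ≥0) : ℝ) := lt_of_lt_of_le (by norm_num) (hβ i).1
    rw [Pi.inv_apply, Units.val_inv_eq_inv_val, NNReal.coe_inv]
    constructor
    · rw [le_inv_comm₀ (by norm_num) hpos]; norm_num; exact (hβ i).2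
    · rw [inv_le_comm₀ hpos (by norm_num)]
      exact le_trans (by norm_num) (hβ i).1
  obtain ⟨T, hT, hsub⟩ := Units.exists_isCompact_superset_of_val_of_inv hCMc hCMc hS₁ hS₂
  exact ⟨T, hT, fun β hβ => hsub ⟨β, hβ, rfl⟩⟩

end Literature.NumberTheory.Automorphic
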